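import Literature.Computability.Cryptography.VanDamSeroussiOracleBQP
import Summits.QuantumAdvantage.QuantumAdvantage.Theses.MobiusLadder

/-!
# Route `MobiusLadder`, item `LiouvilleMemBQP` (stmt-QuantumAdvantage-1400): the Liouville language is in `BQP`

The support item of route `QuantumAdvantage/MobiusLadder` (the quantum half of every rung of the ladder and of
the route's Assembly): the Liouville language

  `L_λ = encodingNatBool.toLanguage {N : ℕ | λ(N) = −1}`  (canonical LSB-first numerals of the `N` with `Ω(N)` odd)

is in the tree's strict class `Literature.Computability.Cryptography.BQP`. Proof (Shor 1997, §5, plus one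
classical wrap, the pattern of `Theorems/ArithStatLadderAvgFaceBeyondPriorFactorBits.lean` and
`Literature/Computability/Cryptography/VanDamSeroussiOracleBQP.lean`):

* Shor's theorem in search form (`factoring_mem_FBQP`, discharged in the tree as `factoring_mem_FBQP_holds`,
  `ShorAssemblyLeavesProofs.lean`): on input `x` the uniform Clifford+T family writes, with probability `≥ 2/3`,
  a string extending `code(primeFactorsList (decodeNat x))`;
* ONE classical wrap (`isQSolvable_classicalWrap_holds`, Bernstein–Vazirani 1997, §8) with the identity
  pre-processor and the `FP` post-processor `⟨x, y⟩ ↦ [x is a canonical numeral ∧ |parseF y| is odd]`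
  (the list code `listE natE` is self-delimiting, `VDSOracle.parseF_certCode_append`; the post-processor is
  assembled in the typed `CodeFP` algebra, no machine is written);
* decision from search (`mem_BQP_of_isQSolvable_bit`): the answer bit is `true` iff `x ∈ L_λ`, because
  `λ(N) = (−1)^{Ω(N)}` for `N ≠ 0` (Mathlib `ArithmeticFunction.liouville_apply`, `cardFactors_apply`),
  `λ(0) = 0 ≠ −1` and `primeFactorsList 0 = []` has even length, and non-canonical strings are neither accepted
  nor in the image language.

`liouvilleMemBQP_of_factoring` keeps Shor's theorem as the hypothesis `factoring_mem_FBQP` (it is the content of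
the sibling item `ShorToLiouville`, stmt-QuantumAdvantage-1401); `LiouvilleMemBQP_proof` discharges it with
`factoring_mem_FBQP_holds`. Everything used is proved in the tree; no definition, no named fact.

## References

* P. W. Shor, *Polynomial-time algorithms for prime factorization and discrete logarithms on a quantum
  computer*, SIAM J. Comput. 26 (1997) 1484–1509, §5 [Shor1997].
* E. Bernstein, U. Vazirani, *Quantum complexity theory*, SIAM J. Comput. 26 (1997) 1411–1473, Def. 8 and §8
  [BernsteinVazirani1997].
-/

set_option linter.dupNamespace false -- D-0017: single-problem summit ⇒ `QuantumAdvantage.QuantumAdvantage` by design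

namespace Summit.QuantumAdvantage.QuantumAdvantage.Theorems.MobiusLadder

open _root_.Computability
open Literature.Computability.Complexity Literature.Computability.Cryptography
open Literature.Computability.Complexity.Brick Literature.Computability.Complexity.CodeFP

/-! ### The post-processor, in the typed `CodeFP` algebra -/

/-- `fstF` on strings (private one-liner, as in `VanDamSeroussiOracleFP.lean`). [folklore] -/
private theorem codeFP_fstF : CodeFP strE strE fstF := ⟨fstF, fstF_mem_FP, fun _ => rfl⟩

/-- `sndF` on strings (private one-liner, as in `VanDamSeroussiOracleFP.lean`). [folklore] -/
private theorem codeFP_sndF : CodeFP strE strE sndF := ⟨sndF, sndF_mem_FP, fun _ => rfl⟩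

/-- **The parity of a binary numeral is polynomial time** (`n ↦ [n % 2 = 1]`, one remainder and one
comparison of numerals). [folklore] -/
theorem codeFP_natOdd : CodeFP natE bitE (fun n : ℕ => decide (n % 2 = 1)) :=
  (natEq.comp ((natMod.comp ((CodeFP.id natE).pair (const natE 2))).pair (const natE 1))).congr fun _ => rfl

/-- **The canonical-numeral test is polynomial time**: `x ↦ [encodeNat (bitsToNat x) = x]` (re-encode the
value and compare the strings). [folklore] -/
theorem codeFP_isCanonical : CodeFP strE bitE (fun x => decide (encodeNat (bitsToNat x) = x)) := by
  have hcanon : CodeFP strE strE (fun w => encodeNat (bitsToNat w)) := (strOfNat.comp strVal).congr fun _ => rfl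
  exact ((CodeFP.eq (eα := strE) Function.injective_id).comp (hcanon.pair (CodeFP.id strE))).congr fun _ => rfl

/-- **The post-processor is polynomial time**: on `v = ⟨x, y⟩`,
`[x is a canonical numeral ∧ the parsed factor list of y has odd length]`. [folklore] -/
theorem codeFP_post : CodeFP strE bitE (fun v =>
    decide (encodeNat (bitsToNat (fstF v)) = fstF v) &&
      decide ((VDSOracle.parseF (sndF v)).length % 2 = 1)) := by
  have h1 := codeFP_isCanonical.comp codeFP_fstF
  have h2 := codeFP_natOdd.comp ((natLength natE).comp (VDSOracle.codeFP_parseF.comp codeFP_sndF))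
  exact (h1.and h2).congr fun _ => rfl

/-- The post-processor as an `FP` string function with its value on pairs. [folklore] -/
theorem exists_post : ∃ g ∈ FP, ∀ x y : List Bool, g (boolPair x y) =
    [decide (encodeNat (bitsToNat x) = x) && decide ((VDSOracle.parseF y).length % 2 = 1)] := by
  obtain ⟨g, hg, h⟩ := codeFP_post
  refine ⟨g, hg, fun x y => ?_⟩
  have := h (boolPair x y)
  simp only [fstF_boolPair, sndF_boolPair] at this
  exact this

/-! ### The answer bit decides the Liouville language -/

/-- **`λ(N) = −1` iff the prime-factor list of `N` has odd length** (`λ(N) = (−1)^{Ω(N)}` for `N ≠ 0`,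
`Ω(N) = |primeFactorsList N|`; `λ(0) = 0` and `primeFactorsList 0 = []`). [folklore] -/
theorem liouville_eq_neg_one_iff (N : ℕ) :
    ArithmeticFunction.liouville N = -1 ↔ N.primeFactorsList.length % 2 = 1 := by
  rcases Nat.eq_zero_or_pos N with rfl | hN
  · simp [Nat.primeFactorsList_zero]
  · rw [ArithmeticFunction.liouville_apply hN.ne', ArithmeticFunction.cardFactors_apply, ← Nat.odd_iff]
    constructor
    · intro h
      rcases Nat.even_or_odd N.primeFactorsList.length with he | ho
      · rw [he.neg_one_pow] at h
        norm_num at h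
      · exact ho
    · intro ho
      exact ho.neg_one_pow

/-- **The answer bit of `L_λ`**: `[x canonical ∧ |primeFactorsList (decodeNat x)| odd]` is `true` iff
`x ∈ encodingNatBool.toLanguage {N | λ(N) = −1}` (canonical numerals are injective). [folklore] -/
theorem liouvilleBit_eq_true_iff (x : List Bool) :
    (decide (encodeNat (bitsToNat x) = x) && decide ((decodeNat x).primeFactorsList.length % 2 = 1)) = true ↔
      x ∈ encodingNatBool.toLanguage {N : ℕ | ArithmeticFunction.liouville N = -1} := by
  change _ ↔ x ∈ encodingNatBool.encode '' {N : ℕ | ArithmeticFunction.liouville N = -1}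
  rw [Set.mem_image, Bool.and_eq_true, decide_eq_true_eq, decide_eq_true_eq]
  constructor
  · rintro ⟨hcanon, hodd⟩
    have hdec : decodeNat x = bitsToNat x := by
      conv_lhs => rw [← hcanon]
      exact decode_encodeNat _
    rw [hdec] at hodd
    exact ⟨bitsToNat x, (liouville_eq_neg_one_iff _).2 hodd, hcanon⟩
  · rintro ⟨N, hN, rfl⟩
    rw [Set.mem_setOf_eq, liouville_eq_neg_one_iff] at hN
    refine ⟨?_, ?_⟩
    · change encodeNat (bitsToNat (encodeNat N)) = encodeNat N
      rw [bitsToNat_encodeNat]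
    · change (decodeNat (encodeNat N)).primeFactorsList.length % 2 = 1
      rwa [decode_encodeNat]

/-! ### The language is in `BQP` -/

/-- **`L_λ ∈ BQP` from Shor's theorem in `FBQP` form** (the content of the sibling item `ShorToLiouville`):
run the factoring family on the input numeral, wrap it classically with the identity pre-processor and the
post-processor of `exists_post` (`isQSolvable_classicalWrap_holds`), observe that the wrapped family writes the
answer bit of `liouvilleBit_eq_true_iff` first (`VDSOracle.parseF_certCode_append`), and read wire `0`
(`mem_BQP_of_isQSolvable_bit`). [cite: Shor1997, §5] [cite: BernsteinVazirani1997, Def. 8 and §8] -/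
theorem liouvilleMemBQP_of_factoring (hShor : factoring_mem_FBQP) :
    encodingNatBool.toLanguage {N : ℕ | ArithmeticFunction.liouville N = -1} ∈ BQP := by
  obtain ⟨g, hg, hpost⟩ := exists_post
  have hF : IsQSolvable fun x =>
      {y : List Bool | encodingListNatBool.encode (decodeNat x).primeFactorsList <+: y} := hShor
  have hW := isQSolvable_classicalWrap_holds (fun x : List Bool => x) g (PolyTimeComputable.id _) hg hF
  have hbit : IsQSolvable fun x => {z |
      [decide (encodeNat (bitsToNat x) = x) && decide ((decodeNat x).primeFactorsList.length % 2 = 1)] <+: z} := by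
    refine hW.mono fun x z hz => ?_
    obtain ⟨y, hy, hz⟩ := hz
    simp only [Set.mem_setOf_eq] at hy
    rw [VDSOracle.encode_primeFactorsList_eq] at hy
    obtain ⟨pad, rfl⟩ := hy
    rw [hpost, VDSOracle.parseF_certCode_append] at hz
    exact hz
  exact mem_BQP_of_isQSolvable_bit (fun _ _ => QCircuit.outputPMF_apply_holds) cliffordT_isUnitary_holds
    liouvilleBit_eq_true_iff hbit

/-- Settles `stmt-QuantumAdvantage-1400` (route MobiusLadder, support `LiouvilleMemBQP`): **the Liouville
language `{bin(N) : λ(N) = −1}` is in `BQP`** — `liouvilleMemBQP_of_factoring` applied to the tree's discharged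
Shor theorem `factoring_mem_FBQP_holds`. [cite: Shor1997, §5] -/
theorem LiouvilleMemBQP_proof :
    Summit.QuantumAdvantage.QuantumAdvantage.Theses.MobiusLadder.LiouvilleMemBQP := by
  unfold Summit.QuantumAdvantage.QuantumAdvantage.Theses.MobiusLadder.LiouvilleMemBQP
  exact liouvilleMemBQP_of_factoring factoring_mem_FBQP_holds

end Summit.QuantumAdvantage.QuantumAdvantage.Theorems.MobiusLadder
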